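import Literature.AlgebraicGeometry.Limits.LocalizationSmoothSpread
import Mathlib.AlgebraicGeometry.Morphisms.Separated
import Mathlib.AlgebraicGeometry.Morphisms.Immersion
import HarnessLib

/-!
# Limits of schemes: separated over `Spec A_S` ⇒ separated over some `D(s)`

Topic: `Literature/AlgebraicGeometry/Limits`; fifth file on the localization diagram
(`Limits/LocalizationDiagram`: `Spec A_S = lim_{s ∈ S} Spec A[1/s]`; `Limits/LocalizationProdLimit`:
`P ×_A Spec A_S = lim_s P ×_A Spec A[1/s]` and Stacks 01ZC; `Limits/LocalizationIsoSpread`: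
isomorphisms spread out; `Limits/LocalizationSmoothSpread`: smoothness spreads out). Main result
(`LocApprox.exists_forall_isSeparated_snd`): let `P → Spec A` be quasi-compact and quasi-separated,
`S ⊆ A` a submonoid and `A_S` its localization. If the base change `P ×_A Spec A_S → Spec A_S` is
separated, then there is `s ∈ S` such that `P ×_A Spec T → Spec T` is separated for every multiple
`t` of `s` and every model `T` of `A[1/t]` — **separatedness descends through the limit
`Spec A_S = lim Spec A[1/s]`** (EGA IV₃ 8.10.5 (v), for the cofiltered system of basic open
neighbourhoods; cf. The Stacks project, Tag 01ZM ff.). With `S = A ∖ 𝔭`: a quasi-compact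
quasi-separated `A`-scheme which is separated over the local ring `A_𝔭` is separated over an open
neighbourhood `D(s)` of `𝔭`; with `A` a domain and `A_S` its fraction field: separated generic fibre
⇒ separated over a dense open subset. No finiteness beyond quasi-compactness and
quasi-separatedness of `P → Spec A` is needed. Consumer in this tree: the local-to-global construction
of Néron models (`Literature.NumberTheory.EllipticCurves.NeronModel*`: a model over an open
neighbourhood of `𝔭` of the local Néron model at `𝔭` is separated after shrinking).

## Proof

Let `Δ : P → P ×_A P` be the diagonal, a quasi-compact immersion, so that its image `Δ(P)` is
locally closed and `W := coborder Δ(P)` (the complement of `closure Δ(P) ∖ Δ(P)`, Mathlib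
`Scheme.Hom.coborderRange`) is open. For any `i : T → Spec A`, the diagonal of the base change
`P ×_A T → T` is the base change of `Δ` along `π : (P ×_A P) ×_A T → P ×_A P`
(Mathlib `diagonal_pullback_fst`), a preimmersion with image `π⁻¹(Δ(P))`; hence `P ×_A T → T` is
separated iff `π⁻¹(Δ(P))` is closed (`isSeparated_snd_iff_isClosed_preimage_range_diagonal`), and,
when `i` is an open immersion, iff `π` lands in `W`
(`isSeparated_snd_iff_range_fst_subset_coborderRange`). For `T = Spec A_S` the map `π` is a
topological embedding whose image is stable under generalization, and every point of
`closure Δ(P)` is a specialization of a point of `Δ(P)` (`exists_specializes_of_mem_closure_range`,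
valid for any quasi-compact morphism: affine-locally the closure of the image of `Spec R' → Spec R`
is `V(ker)`, whose points contain contracted primes); chasing a point of `π⁻¹(closure Δ(P))` through
these facts shows that `π` lands in `W` when `P ×_A Spec A_S → Spec A_S` is separated
(`range_fst_subset_coborderRange_of_isSeparated`). As `(P ×_A P) ×_A Spec A_S = lim_s (P ×_A P) ×_A Spec A[1/s]`
is a limit of quasi-compact schemes (`LocApprox.isLimitProdCone`), the preimage of `W` is already
everything at some stage `s` (Mathlib `exists_map_eq_top`), i.e. `P` is separated over `D(s)`, and
then over every `D(t) ⊆ D(s)`.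

## References

* A. Grothendieck, EGA IV₃, §8.10, Thm. 8.10.5 (v) (Publ. Math. IHÉS 28, 1966). [EGAIV3]
* The Stacks project, Tags 01K9 (quasi-compact morphisms: closed iff specializing), 01ZM ff.
  (limits of schemes). [StacksProject]
* U. Görtz, T. Wedhorn, *Algebraic Geometry I: Schemes*, 2nd ed. (2020), (10.13) (PROP)
  ("compatible with inductive limits of rings", PDF p. 322) and Appendix C, entry "separated"
  ((IND): [EGAIV] (8.10.5); PDF p. 729). [GortzWedhorn2020]
-/

noncomputable section

universe u

open CategoryTheory CategoryTheory.Limits AlgebraicGeometry TopologicalSpace MonoidalCategory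
open Opposite Topology

namespace Literature.AlgebraicGeometry.Limits

namespace LocApprox

open Literature.AlgebraicGeometry.Motives (SchemeOver specOver)

set_option backward.isDefEq.respectTransparency false

/-! ## Separatedness of a base change, read off on the diagonal of the original morphism -/

section Diagonal

variable {X S T : Scheme.{u}} (f : X ⟶ S) (i : T ⟶ S)

/-- The base change of the diagonal `Δ_f : X → X ×_S X` along `(X ×_S X) ×_S T → X ×_S X` is the
morphism `X ×_S T → (X ×_S X) ×_S T` induced by `Δ_f` (pasting of pullback squares). [folklore] -/
theorem isPullback_pullback_map_diagonal :
    IsPullback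
      ((Over.pullback i).map
        (Over.homMk (pullback.diagonal f) : Over.mk f ⟶ Over.mk (pullback.snd f f ≫ f))).left
      (pullback.fst f i) (pullback.fst (pullback.snd f f ≫ f) i) (pullback.diagonal f) := by
  set q : pullback f f ⟶ S := pullback.snd f f ≫ f
  set m := ((Over.pullback i).map
    (Over.homMk (pullback.diagonal f) : Over.mk f ⟶ Over.mk q)).left
  have e1 : m ≫ pullback.snd q i = pullback.snd f i := by
    simp [m]
  have e2 : pullback.diagonal f ≫ q = f := by
    simp [q]
  have outer : IsPullback (m ≫ pullback.snd q i) (pullback.fst f i) i (pullback.diagonal f ≫ q) := by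
    rw [e1, e2]
    exact (IsPullback.of_hasPullback f i).flip
  exact outer.of_right (by simp [m, q]) (IsPullback.of_hasPullback q i).flip

/-- **Separatedness of a base change in terms of the diagonal of the original morphism.** For
`f : X → S` and `i : T → S`, the base change `X ×_S T → T` is separated iff the preimage of the
(locally closed) image of the diagonal `Δ_f : X → X ×_S X` under `(X ×_S X) ×_S T → X ×_S X` is
closed: the diagonal of `X ×_S T → T` is the base change of `Δ_f` along this map (Mathlib
`diagonal_pullback_fst`), a preimmersion, which is a closed immersion iff its image —
the said preimage — is closed. [folklore] -/
theorem isSeparated_snd_iff_isClosed_preimage_range_diagonal :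
    IsSeparated (pullback.snd f i) ↔
      IsClosed ((pullback.fst (pullback.snd f f ≫ f) i) ⁻¹' Set.range (pullback.diagonal f)) := by
  set q : pullback f f ⟶ S := pullback.snd f f ≫ f
  set m := ((Over.pullback i).map
    (Over.homMk (pullback.diagonal f) : Over.mk f ⟶ Over.mk q)).left
  have sq : IsPullback m (pullback.fst f i) (pullback.fst q i) (pullback.diagonal f) :=
    isPullback_pullback_map_diagonal f i
  -- `snd f i` versus `fst i f`
  have hsym : pullback.snd f i = (pullbackSymmetry f i).hom ≫ pullback.fst i f :=
    (pullbackSymmetry_hom_comp_fst f i).symm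
  rw [hsym, MorphismProperty.cancel_left_of_respectsIso @IsSeparated]
  -- separated iff the diagonal is a closed immersion, and the diagonal is `m` up to isomorphisms
  have hdiag : IsSeparated (pullback.fst i f) ↔ IsClosedImmersion m := by
    constructor
    · intro h
      have h' := h.isClosedImmersion_diagonal
      rw [diagonal_pullback_fst, MorphismProperty.cancel_left_of_respectsIso @IsClosedImmersion,
        MorphismProperty.cancel_right_of_respectsIso @IsClosedImmersion] at h'
      exact h'
    · intro h
      refine ⟨?_⟩
      rw [diagonal_pullback_fst, MorphismProperty.cancel_left_of_respectsIso @IsClosedImmersion,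
        MorphismProperty.cancel_right_of_respectsIso @IsClosedImmersion]
      exact h
  rw [hdiag]
  -- `m` is a preimmersion (base change of the immersion `Δ_f`), closed immersion iff closed image
  haveI : IsPreimmersion m := MorphismProperty.of_isPullback sq.flip inferInstance
  rw [IsClosedImmersion.iff_isPreimmersion, and_iff_right this]
  -- the image of `m` is the preimage of the image of `Δ_f`
  have hrange : Set.range m = (pullback.fst q i) ⁻¹' Set.range (pullback.diagonal f) := by
    rw [← sq.isoPullback_hom_fst]
    change Set.range (pullback.fst (pullback.fst q i) (pullback.diagonal f) ∘ sq.isoPullback.hom) = _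
    rw [Set.range_comp, Set.range_eq_univ.mpr sq.isoPullback.hom.surjective, Set.image_univ,
      Scheme.Pullback.range_fst]
  rw [hrange]

end Diagonal

/-! ## Quasi-compact morphisms: the closure of the image consists of specializations -/

section Specializes

/-- For a ring map `θ : R → R'`, every point of the closure of the image of `Spec R' → Spec R` is a
specialization of a point of the image: the closure is `V(ker θ)`, and every prime containing
`ker θ = θ⁻¹(0)` contains the contraction of a prime of `R'` (Mathlib
`Ideal.exists_ideal_comap_le_prime`). [folklore] -/
theorem _root_.PrimeSpectrum.exists_mem_range_comap_specializes {R R' : Type*} [CommRing R]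
    [CommRing R'] (θ : R →+* R') {x : PrimeSpectrum R}
    (hx : x ∈ closure (Set.range (PrimeSpectrum.comap θ))) :
    ∃ y ∈ Set.range (PrimeSpectrum.comap θ), y ⤳ x := by
  rw [PrimeSpectrum.closure_range_comap, PrimeSpectrum.mem_zeroLocus, RingHom.ker_eq_comap_bot,
    SetLike.coe_subset_coe] at hx
  obtain ⟨q, -, hq, hqle⟩ := x.asIdeal.exists_ideal_comap_le_prime (⊥ : Ideal R') hx
  exact ⟨PrimeSpectrum.comap θ ⟨q, hq⟩, ⟨⟨q, hq⟩, rfl⟩,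
    (PrimeSpectrum.le_iff_specializes _ _).mp hqle⟩

/-- **For a quasi-compact morphism `g : X → Y` of schemes, every point of the closure of the image
is a specialization of a point of the image** (The Stacks project, Tag 01K9 and its proof; cf.
Mathlib `isClosedMap_iff_specializingMap`). Proof: in an affine chart `Spec Γ(Y, V) ∋ y` the
preimage of `V` is quasi-compact, hence the image of an affine scheme `Spec R'`, and the trace of
the image of `g` on the chart is the image of `Spec R' → Spec Γ(Y, V)`; apply the affine case.
[cite: StacksProject, Tag 01K9] -/
theorem exists_specializes_of_mem_closure_range {X Y : Scheme.{u}} (g : X ⟶ Y) [QuasiCompact g]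
    {y : Y} (hy : y ∈ closure (Set.range g)) : ∃ x : X, g x ⤳ y := by
  -- an affine open neighbourhood `ι : Spec Γ(Y, V) → Y` of `y`
  obtain ⟨_, ⟨V, hV, rfl⟩, hyV, -⟩ :=
    Y.isBasis_affineOpens.exists_subset_of_mem_open (Set.mem_univ y) isOpen_univ
  set ι := hV.fromSpec with hιdef
  have hrange : Set.range ι = (V : Set Y) := hV.range_fromSpec
  obtain ⟨y₀, rfl⟩ : y ∈ Set.range ι := by rw [hrange]; exact hyV
  -- the preimage of `V` is quasi-compact: the image of an affine scheme `φ : Spec R' → X`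
  have hc : IsCompact ((g ⁻¹ᵁ V : X.Opens) : Set X) :=
    QuasiCompact.isCompact_preimage (f := g) _ V.2 hV.isCompact
  obtain ⟨R', φ, hφ⟩ := isCompact_iff_exists.mp hc
  -- `φ ≫ g` factors through the chart: `ψ : Spec R' → Spec Γ(Y, V)`
  have hsub : Set.range (φ ≫ g) ⊆ Set.range ι := by
    rintro _ ⟨w, rfl⟩
    rw [hrange]
    have hw : φ w ∈ (g ⁻¹ᵁ V : Set X) := by rw [← hφ]; exact ⟨w, rfl⟩
    exact hw
  set ψ := IsOpenImmersion.lift ι (φ ≫ g) hsub with hψdef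
  have hψ : ψ ≫ ι = φ ≫ g := IsOpenImmersion.lift_fac _ _ _
  have hψw : ∀ w, ι (ψ w) = g (φ w) := fun w => by
    rw [← Scheme.Hom.comp_apply, hψ, Scheme.Hom.comp_apply]
  -- `y₀` lies in the closure of the image of `ψ`
  have h1 : y₀ ∈ closure (ι ⁻¹' Set.range g) := by
    rw [← ι.isOpenEmbedding.isOpenMap.preimage_closure_eq_closure_preimage ι.continuous]
    exact hy
  have h2 : ι ⁻¹' Set.range g ⊆ Set.range ψ := by
    rintro v ⟨x, hx⟩
    have hxV : x ∈ (g ⁻¹ᵁ V : Set X) := by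
      change g x ∈ (V : Set Y)
      rw [hx, ← hrange]
      exact ⟨v, rfl⟩
    rw [← hφ] at hxV
    obtain ⟨w, rfl⟩ := hxV
    exact ⟨w, ι.isOpenEmbedding.injective ((hψw w).trans hx)⟩
  have h3 : y₀ ∈ closure (Set.range (PrimeSpectrum.comap (Spec.preimage ψ).hom)) := by
    have e : Set.range (PrimeSpectrum.comap (Spec.preimage ψ).hom) = Set.range ψ := by
      change Set.range (Spec.map (Spec.preimage ψ)) = _
      rw [Spec.map_preimage]
    rw [e]
    exact closure_mono h2 h1
  -- the affine case, transported back to `Y`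
  obtain ⟨_, ⟨w, rfl⟩, hw⟩ := PrimeSpectrum.exists_mem_range_comap_specializes _ h3
  have hw' : ψ w ⤳ y₀ := by
    have e : (PrimeSpectrum.comap (Spec.preimage ψ).hom) w = ψ w := by
      change (Spec.map (Spec.preimage ψ)) w = ψ w
      rw [Spec.map_preimage]
    rwa [e] at hw
  refine ⟨φ w, ?_⟩
  rw [← hψw w]
  exact hw'.map ι.continuous

end Specializes

/-! ## The limit stage: separated over `Spec A_S` ⇒ the image of `(P ×_A P) ×_A Spec A_S` avoids the border of the diagonal -/

section Limit

variable {A : Type u} [CommRing A] (S : Submonoid A) (B : Type u) [CommRing B] [Algebra A B]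
  [IsLocalization S B] (P : SchemeOver A)

include S in
/-- The image of `(P ×_A P) ×_A Spec A_S → P ×_A P` is stable under generalization: it is the
preimage of the image of `Spec A_S → Spec A`, the set of primes not meeting `S`. [folklore] -/
theorem stableUnderGeneralization_range_fst :
    StableUnderGeneralization (Set.range (pullback.fst (pullback.snd P.hom P.hom ≫ P.hom)
      (Spec.map (CommRingCat.ofHom (algebraMap A B))))) := by
  have key : Set.range (Spec.map (CommRingCat.ofHom (algebraMap A B))) =
      {p : PrimeSpectrum A | Disjoint (S : Set A) p.asIdeal} :=
    PrimeSpectrum.localization_comap_range B S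
  rw [Scheme.Pullback.range_fst, key]
  refine StableUnderGeneralization.preimage ?_ (Scheme.Hom.continuous _)
  intro x y hxy hx
  have hle : y.asIdeal ≤ x.asIdeal := (PrimeSpectrum.le_iff_specializes y x).mpr hxy
  exact Set.disjoint_of_subset_right hle hx

include S in
/-- **The limit stage.** If `P ×_A Spec A_S → Spec A_S` is separated (`P` quasi-separated over `A`),
the image of `(P ×_A P) ×_A Spec A_S → P ×_A P` lies in the open set `coborder Δ(P)` off which the
image of the diagonal is closed (Mathlib `Scheme.Hom.coborderRange`). Indeed, let `z = π(z')` lie in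
the closure of `Δ(P)`; the diagonal being quasi-compact, `z` is a specialization of some
`Δ(x)` (`exists_specializes_of_mem_closure_range`); the image of `π` is stable under
generalization, so `Δ(x) = π(y')`, and `y' ⤳ z'` because `π` is an embedding (base change of the
preimmersion `Spec A_S → Spec A`); as `π⁻¹(Δ(P))` is closed (the base change is separated,
`isSeparated_snd_iff_isClosed_preimage_range_diagonal`) it contains `z'`, so `z ∈ Δ(P)`. [folklore] -/
theorem range_fst_subset_coborderRange_of_isSeparated [QuasiSeparated P.hom]
    (h : IsSeparated (pullback.snd P.hom (Spec.map (CommRingCat.ofHom (algebraMap A B))))) :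
    Set.range (pullback.fst (pullback.snd P.hom P.hom ≫ P.hom)
      (Spec.map (CommRingCat.ofHom (algebraMap A B)))) ⊆
      ((pullback.diagonal P.hom).coborderRange : Set _) := by
  set i := Spec.map (CommRingCat.ofHom (algebraMap A B))
  set π := pullback.fst (pullback.snd P.hom P.hom ≫ P.hom) i
  set Δ := pullback.diagonal P.hom
  have hcl : IsClosed (π ⁻¹' Set.range Δ) :=
    (isSeparated_snd_iff_isClosed_preimage_range_diagonal P.hom i).mp h
  haveI : IsPreimmersion i := IsPreimmersion.of_isLocalization S
  have hemb : IsEmbedding π := π.isEmbedding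
  have hgen : StableUnderGeneralization (Set.range π) := stableUnderGeneralization_range_fst S B P
  rintro _ ⟨z', rfl⟩
  change π z' ∈ coborder (Set.range Δ)
  rw [coborder, Set.mem_compl_iff, Set.mem_sdiff, not_and, not_not]
  intro hz
  obtain ⟨x, hx⟩ := exists_specializes_of_mem_closure_range Δ hz
  obtain ⟨y', hy'⟩ : Δ x ∈ Set.range π := hgen hx ⟨z', rfl⟩
  have hspec : y' ⤳ z' := hemb.isInducing.specializes_iff.mp (by rw [hy']; exact hx)
  have hy'mem : y' ∈ π ⁻¹' Set.range Δ := ⟨x, hy'.symm⟩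
  exact hcl.stableUnderSpecialization hspec hy'mem

/-- **Separatedness over an open subscheme of the base, read off on the diagonal.** For an
`A`-algebra `T` with `Spec T → Spec A` an open immersion, `P ×_A Spec T → Spec T` is separated iff
the image of the open immersion `(P ×_A P) ×_A Spec T → P ×_A P` lies in `coborder Δ(P)`
(`isSeparated_snd_iff_isClosed_preimage_range_diagonal`, and for an open embedding `j`,
`j⁻¹(Δ(P))` is closed iff `j` lands in the coborder, Mathlib `IsOpenEmbedding.coborder_preimage`).
[folklore] -/
theorem isSeparated_snd_iff_range_fst_subset_coborderRange (T : Type u) [CommRing T] [Algebra A T]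
    [IsOpenImmersion (Spec.map (CommRingCat.ofHom (algebraMap A T)))] :
    IsSeparated (pullback.snd P.hom (Spec.map (CommRingCat.ofHom (algebraMap A T)))) ↔
      Set.range (pullback.fst (pullback.snd P.hom P.hom ≫ P.hom)
        (Spec.map (CommRingCat.ofHom (algebraMap A T)))) ⊆
        ((pullback.diagonal P.hom).coborderRange : Set _) := by
  set j := pullback.fst (pullback.snd P.hom P.hom ≫ P.hom)
    (Spec.map (CommRingCat.ofHom (algebraMap A T)))
  rw [isSeparated_snd_iff_isClosed_preimage_range_diagonal, ← coborder_eq_univ_iff,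
    j.isOpenEmbedding.coborder_preimage, Set.eq_univ_iff_forall]
  constructor
  · rintro h _ ⟨z, rfl⟩
    exact h z
  · intro h z
    exact h ⟨z, rfl⟩

/-- **Separatedness descends through `Spec A_S = lim Spec A[1/s]`** (EGA IV₃ 8.10.5 (v); The Stacks
project, Tag 01ZR-style descent of properties through limits, here for the cofiltered system of
basic open neighbourhoods `D(s)`, `s ∈ S`, of a localization). Let `P → Spec A` be quasi-compact
and quasi-separated, and suppose the base change `P ×_A Spec A_S → Spec A_S` to the localization
`A_S` is separated. Then there is `s ∈ S` such that for every multiple `t` of `s` and every model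
`T` of `A[1/t]` (`IsLocalization.Away t T`) the base change `P ×_A Spec T → Spec T` is separated.
(With `S = A ∖ 𝔭`, `A_S = A_𝔭`: separated over the local ring `A_𝔭` ⇒ separated over every small
enough basic open neighbourhood `D(t) ∋ 𝔭`; with `A` a domain and `A_S = Frac A`: separated generic
fibre ⇒ separated over a dense open subset.) Proof: the image of `(P ×_A P) ×_A Spec A_S` lies in the
open `coborder Δ(P)` (`range_fst_subset_coborderRange_of_isSeparated`), i.e. the preimage of this
open in the limit `(P ×_A P) ×_A Spec A_S = lim_s (P ×_A P) ×_A Spec A[1/s]` of quasi-compact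
schemes is everything; hence so is its preimage in some stage (Mathlib `exists_map_eq_top`), which
is separatedness over `D(s)` (`isSeparated_snd_iff_range_fst_subset_coborderRange`). (Görtz–Wedhorn I,
(10.13) (PROP): "separated" is compatible with inductive limits of rings, Appendix C, with reference
to EGA IV 8.10.5.) [cite: EGAIV3, Thm. 8.10.5 (v)]
[cite: GortzWedhorn2020, (10.13) (PROP) and Appendix C, entry "separated" (IND)] -/
theorem exists_forall_isSeparated_snd [QuasiCompact P.hom] [QuasiSeparated P.hom]
    (h : IsSeparated (pullback.snd P.hom (Spec.map (CommRingCat.ofHom (algebraMap A B))))) :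
    ∃ s ∈ S, ∀ t : A, s ∣ t → ∀ (T : Type u) [CommRing T] [Algebra A T] [IsLocalization.Away t T],
      IsSeparated (pullback.snd P.hom (Spec.map (CommRingCat.ofHom (algebraMap A T)))) := by
  let Q : SchemeOver A := Over.mk (pullback.snd P.hom P.hom ≫ P.hom)
  haveI : QuasiCompact Q.hom := inferInstanceAs (QuasiCompact (pullback.snd P.hom P.hom ≫ P.hom))
  let W : (pullback P.hom P.hom).Opens := (pullback.diagonal P.hom).coborderRange
  -- the open of the stage `1`, whose preimage in the limit is everything
  let U : ((prodDiagram S Q).obj default).Opens :=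
    (pullback.fst Q.hom (Spec.map (CommRingCat.ofHom (algebraMap A (loc S default))))) ⁻¹ᵁ W
  have hU : (prodCone S B Q).π.app default ⁻¹ᵁ U = ⊤ := by
    change ((prodCone S B Q).π.app default ≫ pullback.fst _ _) ⁻¹ᵁ W = ⊤
    rw [prodCone_π_app_fst, preimage_eq_top_iff_range_subset]
    exact range_fst_subset_coborderRange_of_isSeparated S B P h
  obtain ⟨s, fs, hs⟩ :=
    exists_map_eq_top (prodDiagram S Q) (prodCone S B Q) (isLimitProdCone S B Q) U hU
  have hs' : Set.range (pullback.fst (pullback.snd P.hom P.hom ≫ P.hom)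
      (Spec.map (CommRingCat.ofHom (algebraMap A (loc S s))))) ⊆ (W : Set _) := by
    rw [← preimage_eq_top_iff_range_subset]
    change (pullback.fst Q.hom ((baseDiagram S).obj s).hom) ⁻¹ᵁ W = ⊤
    rw [← prodDiagram_map_fst S Q fs]
    exact hs
  refine ⟨s.val, s.mem, fun t hst T _ _ _ => ?_⟩
  haveI : IsOpenImmersion (Spec.map (CommRingCat.ofHom (algebraMap A T))) :=
    IsOpenImmersion.of_isLocalization t
  have hle : (PrimeSpectrum.basicOpen t : Set (PrimeSpectrum A)) ⊆ PrimeSpectrum.basicOpen s.val := by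
    obtain ⟨c, rfl⟩ := hst
    exact PrimeSpectrum.basicOpen_mul_le_left s.val c
  have e1 : Set.range (pullback.fst (pullback.snd P.hom P.hom ≫ P.hom)
      (Spec.map (CommRingCat.ofHom (algebraMap A T)))) =
        (pullback.snd P.hom P.hom ≫ P.hom) ⁻¹' (PrimeSpectrum.basicOpen t : Set (PrimeSpectrum A)) :=
    range_fst_eq_preimage_basicOpen Q T t
  have e2 : Set.range (pullback.fst (pullback.snd P.hom P.hom ≫ P.hom)
      (Spec.map (CommRingCat.ofHom (algebraMap A (loc S s))))) =
        (pullback.snd P.hom P.hom ≫ P.hom) ⁻¹'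
          (PrimeSpectrum.basicOpen s.val : Set (PrimeSpectrum A)) :=
    range_fst_eq_preimage_basicOpen Q (loc S s) s.val
  rw [isSeparated_snd_iff_range_fst_subset_coborderRange, e1]
  refine subset_trans (Set.preimage_mono hle) ?_
  rw [← e2]
  exact hs'

end Limit

end LocApprox

end Literature.AlgebraicGeometry.Limits

end
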